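import Literature.NumberTheory.BeurlingPrimes.RiemannPrimeCountPsi
import Literature.NumberTheory.BeurlingPrimes.HilberdinkMellin
import Literature.NumberTheory.BeurlingPrimes.EulerProduct
import Mathlib.Analysis.SpecialFunctions.Complex.LogBounds
import HarnessLib

/-!
# `log ζ_𝒫(s) = ∫₁^∞ x^{−s} dΠ_𝒫(x) = s ∫₁^∞ Π_𝒫(x) x^{−s−1} dx`

Topic `Literature/NumberTheory/BeurlingPrimes`. Everything in this file is PROVED.

For a Beurling generalized prime system `𝒫` and `Re s > 0` with `Σ_j λ_j^{−σ} < ∞` (in particular for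
`Re s > 1` whenever `π_𝒫(x) ≪ x`), the Euler product gives
`log ζ_𝒫(s) = Σ_j −log(1 − λ_j^{−s}) = Σ_j Σ_{k ≥ 1} λ_j^{−ks}/k = ∫₁^∞ x^{−s} dΠ_𝒫(x)` (BDR 2023, proof of
Theorem 3.2: "`log ζ_𝒫(s) = Σ_{p_j ∈ 𝒫} log(1/(1 − p_j^{−s})) = ∫₁^∞ x^{−s} dΠ_𝒫(x) = ℳ{dΠ_𝒫; s}`"; BV 2024,
(3.1): "`ζ_𝒫(s) = ∫_{1⁻}^∞ x^{−s} dN_𝒫(x) = exp(∫_{1⁻}^∞ x^{−s} dΠ_𝒫(x))`"), where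
`Π_𝒫(x) = Σ_{λ_j^k ≤ x} 1/k` is Riemann's prime-counting function (tree: `BeurlingPrimes.riemannPrimeCount`).
Since `Π_𝒫` is a step function vanishing on `[0, 1)`, the Mellin–Stieltjes transform is the absolutely
convergent integral `s ∫₁^∞ Π_𝒫(x) x^{−s−1} dx` (integration by parts), and this is the form proved here:

* `mul_integral_riemannPrimeCount_eq_tsum` — `s ∫₁^∞ Π_𝒫(x) x^{−s−1} dx = Σ_{(j,k)} λ_j^{−(k+1)s}/(k+1)`
  (Fubini for counting functions, tree `Hilberdink.mul_setIntegral_counting_eq_tsum`);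
* `log_eulerFactor_hasSum` — `log((1 − λ_j^{−s})⁻¹) = Σ_k λ_j^{−(k+1)s}/(k+1)` (Mercator series);
* `zeta_eq_exp_mul_integral_riemannPrimeCount` — **`ζ_𝒫(s) = exp(s ∫₁^∞ Π_𝒫(x) x^{−s−1} dx)`**
  (with the tree's Euler product `BeurlingPrimes.zeta_eq_exp_tsum`).

This is the "Mellin side" of the constructions of BDR 2023 §§3–4 / BV 2024 §3, where one writes
`ζ_𝒫(s) = exp(ℳ{dG; s}) · exp(ℳ{dΠ_𝒫 − dG; s}) = E(s) e^{Z(s)}` for a template `G`.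

## References
* [BrouckeDebruyneRevesz2023] F. Broucke, G. Debruyne, Sz. Gy. Révész, *Some examples of well-behaved Beurling
  number systems*, arXiv:2309.01567, proof of Theorem 3.2 (the display `log ζ_𝒫(s) = … = ℳ{dΠ_𝒫; s}`) (read).
* [BrouckeVindas2024] F. Broucke, J. Vindas, Math. Z. 307 (2024), arXiv:2102.08478, §3 (3.1) (read).
-/

noncomputable section

open Complex Filter Set MeasureTheory Real
open scoped Topology

namespace Literature.NumberTheory.BeurlingPrimes

open Literature.Barriers.RiemannHypothesis

variable (P : BeurlingPrimes)

/-! ### Elementary identities -/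

/-- `((r^n : ℝ) : ℂ)^w = ((r : ℂ)^w)^n` for `r > 0` (both equal `exp(n w log r)`). [folklore] -/
theorem ofReal_pow_cpow {r : ℝ} (hr : 0 < r) (n : ℕ) (w : ℂ) :
    (((r ^ n : ℝ)) : ℂ) ^ w = (((r : ℝ) : ℂ) ^ w) ^ n := by
  have hr0 : ((r : ℝ) : ℂ) ≠ 0 := ofReal_ne_zero.2 hr.ne'
  have hrn : (((r ^ n : ℝ)) : ℂ) ≠ 0 := ofReal_ne_zero.2 (pow_pos hr n).ne'
  rw [cpow_def_of_ne_zero hrn, cpow_def_of_ne_zero hr0, ← Complex.exp_nat_mul]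
  congr 1
  rw [show (((r ^ n : ℝ)) : ℂ) = (((r : ℝ) : ℂ)) ^ n by push_cast; ring, ← ofReal_pow,
    ← ofReal_log (pow_pos hr n).le, ← ofReal_log hr.le, Real.log_pow]
  push_cast
  ring

/-- `(r^(k+1))^{−σ} = (r^{−σ})^{k+1}` for `r > 0` (real powers). [folklore] -/
theorem pow_rpow_neg_eq {r : ℝ} (hr : 0 < r) (k : ℕ) (σ : ℝ) :
    (r ^ (k + 1)) ^ (-σ) = (r ^ (-σ)) ^ (k + 1) := by
  rw [← Real.rpow_natCast r (k + 1), ← Real.rpow_mul hr.le, mul_comm, Real.rpow_mul hr.le,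
    Real.rpow_natCast]

/-! ### Summability over prime powers -/

/-- The prime-power weights `(j, k) ↦ λ_j^{−(k+1)σ}/(k+1)` are summable when `Σ_j λ_j^{−σ} < ∞`
(`σ > 0`): `Σ_k λ_j^{−(k+1)σ}/(k+1) ≤ λ_j^{−σ}/(1 − λ_0^{−σ})`. [folklore] -/
theorem summable_primePow_weight {σ : ℝ} (hσ : 0 < σ) (hsum : Summable fun j ↦ P.prime j ^ (-σ)) :
    Summable fun jk : ℕ × ℕ ↦ 1 / ((jk.2 : ℝ) + 1) * (P.prime jk.1 ^ (jk.2 + 1)) ^ (-σ) := by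
  -- `q_j = λ_j^{−σ} ∈ (0, q₀]`, `q₀ = λ_0^{−σ} < 1`
  set q : ℕ → ℝ := fun j ↦ P.prime j ^ (-σ) with hq
  have hq0 : ∀ j, 0 < q j := fun j ↦ Real.rpow_pos_of_pos (P.prime_pos j) _
  have hq1 : ∀ j, q j < 1 := fun j ↦
    Real.rpow_lt_one_of_one_lt_of_neg (P.one_lt_prime j) (by linarith)
  have hqle : ∀ j, q j ≤ q 0 := fun j ↦
    Real.rpow_le_rpow_of_nonpos (P.prime_pos 0) (P.mono (Nat.zero_le j)) (by linarith)
  have hnonneg : ∀ jk : ℕ × ℕ, 0 ≤ 1 / ((jk.2 : ℝ) + 1) * (P.prime jk.1 ^ (jk.2 + 1)) ^ (-σ) := fun jk ↦ by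
    have := P.prime_pos jk.1; positivity
  have hterm : ∀ jk : ℕ × ℕ, 1 / ((jk.2 : ℝ) + 1) * (P.prime jk.1 ^ (jk.2 + 1)) ^ (-σ) ≤ q jk.1 ^ (jk.2 + 1) := by
    intro jk
    rw [pow_rpow_neg_eq (P.prime_pos jk.1)]
    have h1 : 1 / ((jk.2 : ℝ) + 1) ≤ 1 := by
      rw [div_le_one (by positivity)]; linarith [(Nat.cast_nonneg jk.2 : (0 : ℝ) ≤ jk.2)]
    have h2 : 0 ≤ q jk.1 ^ (jk.2 + 1) := pow_nonneg (hq0 jk.1).le _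
    calc 1 / ((jk.2 : ℝ) + 1) * (P.prime jk.1 ^ (-σ)) ^ (jk.2 + 1) ≤ 1 * (P.prime jk.1 ^ (-σ)) ^ (jk.2 + 1) :=
          mul_le_mul_of_nonneg_right h1 h2
      _ = q jk.1 ^ (jk.2 + 1) := one_mul _
  -- geometric fibres
  have hgeo : ∀ j, HasSum (fun k : ℕ ↦ q j ^ (k + 1)) (q j / (1 - q j)) := by
    intro j
    have h := (hasSum_geometric_of_lt_one (hq0 j).le (hq1 j)).mul_left (q j)
    have heq : (fun k : ℕ ↦ q j * q j ^ k) = fun k ↦ q j ^ (k + 1) := by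
      funext k; ring
    rw [heq] at h
    rw [div_eq_mul_inv]
    exact h
  rw [summable_prod_of_nonneg hnonneg]
  refine ⟨fun j ↦ ?_, ?_⟩
  · exact Summable.of_nonneg_of_le (fun k ↦ hnonneg (j, k)) (fun k ↦ hterm (j, k)) (hgeo j).summable
  · have hbound : ∀ j : ℕ, ∑' k : ℕ, 1 / ((k : ℝ) + 1) * (P.prime j ^ (k + 1)) ^ (-σ) ≤ (1 / (1 - q 0)) * q j := by
      intro j
      have h1 : ∑' k : ℕ, 1 / ((k : ℝ) + 1) * (P.prime j ^ (k + 1)) ^ (-σ) ≤ ∑' k : ℕ, q j ^ (k + 1) :=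
        Summable.tsum_le_tsum (fun k ↦ hterm (j, k))
          (Summable.of_nonneg_of_le (fun k ↦ hnonneg (j, k)) (fun k ↦ hterm (j, k)) (hgeo j).summable)
          (hgeo j).summable
      rw [(hgeo j).tsum_eq] at h1
      refine h1.trans ?_
      have h1q : 0 < 1 - q 0 := by linarith [hq1 0]
      have h1qj : 0 < 1 - q j := by linarith [hq1 j]
      rw [div_le_iff₀ h1qj, one_div, mul_assoc, ← div_eq_inv_mul, le_div_iff₀ h1q]
      have := hqle j
      have := hq0 j
      nlinarith
    refine Summable.of_nonneg_of_le (fun j ↦ tsum_nonneg fun k ↦ hnonneg (j, k)) hbound ?_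
    exact hsum.mul_left _

/-! ### `s ∫₁^∞ Π_𝒫(x) x^{−s−1} dx` as the prime-power sum -/

/-- The family defining `Π_𝒫(x)` has sum `Π_𝒫(x)` (it is finitely supported). [folklore] -/
theorem _root_.Literature.Barriers.RiemannHypothesis.BeurlingPrimes.hasSum_riemannPrimeCount (x : ℝ) :
    HasSum (fun jk : ℕ × ℕ ↦ if P.prime jk.1 ^ (jk.2 + 1) ≤ x then 1 / ((jk.2 : ℝ) + 1) else 0)
      (P.riemannPrimeCount x) :=
  (summable_of_ne_finset_zero (s := P.psiSupport x) fun _ hjk ↦ P.piTerm_eq_zero_of_le le_rfl hjk).hasSum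

/-- Complex-valued version of `hasSum_riemannPrimeCount`. [folklore] -/
theorem _root_.Literature.Barriers.RiemannHypothesis.BeurlingPrimes.hasSum_riemannPrimeCount_complex (x : ℝ) :
    HasSum (fun jk : ℕ × ℕ ↦ if P.prime jk.1 ^ (jk.2 + 1) ≤ x then (((1 / ((jk.2 : ℝ) + 1) : ℝ)) : ℂ) else 0)
      ((P.riemannPrimeCount x : ℝ) : ℂ) := by
  have h := (P.hasSum_riemannPrimeCount x).mapL Complex.ofRealCLM
  simp only [Complex.ofRealCLM_apply] at h
  convert h using 1
  funext jk
  split_ifs <;> simp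

/-- **`s ∫₁^∞ Π_𝒫(x) x^{−s−1} dx = Σ_{j} Σ_{k ≥ 1} λ_j^{−ks}/k`** (as a sum over `(j, k−1) ∈ ℕ × ℕ`), for
`Re s > 0` with `Σ_j λ_j^{−σ} < ∞`: the Mellin–Stieltjes transform `ℳ{dΠ_𝒫; s} = ∫₁^∞ x^{−s} dΠ_𝒫(x)` after
integration by parts. [cite: BrouckeDebruyneRevesz2023, proof of Theorem 3.2] -/
theorem _root_.Literature.Barriers.RiemannHypothesis.BeurlingPrimes.mul_integral_riemannPrimeCount_eq_tsum
    {s : ℂ} (hs : 0 < s.re) (hsum : Summable fun j ↦ P.prime j ^ (-s.re)) :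
    s * ∫ x in Ioi (1 : ℝ), ((P.riemannPrimeCount x : ℝ) : ℂ) * (x : ℂ) ^ (-s - 1) =
      ∑' jk : ℕ × ℕ, (((1 / ((jk.2 : ℝ) + 1) : ℝ)) : ℂ) * (((P.prime jk.1 ^ (jk.2 + 1) : ℝ)) : ℂ) ^ (-s) := by
  have hv : ∀ jk : ℕ × ℕ, (1 : ℝ) ≤ P.prime jk.1 ^ (jk.2 + 1) := fun jk ↦
    one_le_pow₀ (P.one_lt_prime jk.1).le
  have hsum' : Summable fun jk : ℕ × ℕ ↦
      ‖(((1 / ((jk.2 : ℝ) + 1) : ℝ)) : ℂ)‖ * (P.prime jk.1 ^ (jk.2 + 1)) ^ (-s.re) := by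
    refine (summable_primePow_weight P hs hsum).congr fun jk ↦ ?_
    rw [Complex.norm_real, Real.norm_eq_abs, abs_of_nonneg (by positivity)]
  exact Hilberdink.mul_setIntegral_counting_eq_tsum hv hs hsum' (P.hasSum_riemannPrimeCount_complex)

/-! ### The Euler factor and the main identity -/

/-- **Mercator series for one Euler factor**: `log((1 − λ_j^{−s})⁻¹) = Σ_{k ≥ 0} λ_j^{−(k+1)s}/(k+1)` for
`Re s > 0` (`‖λ_j^{−s}‖ < 1`). [cite: BrouckeDebruyneRevesz2023, proof of Theorem 3.2] -/
theorem _root_.Literature.Barriers.RiemannHypothesis.BeurlingPrimes.log_eulerFactor_hasSum {s : ℂ}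
    (hs : 0 < s.re) (j : ℕ) :
    HasSum (fun k : ℕ ↦ (((1 / ((k : ℝ) + 1) : ℝ)) : ℂ) * (((P.prime j ^ (k + 1) : ℝ)) : ℂ) ^ (-s))
      (Complex.log ((1 - ((P.prime j : ℝ) : ℂ) ^ (-s))⁻¹)) := by
  set q : ℂ := ((P.prime j : ℝ) : ℂ) ^ (-s) with hq
  have hq1 : ‖q‖ < 1 := by
    rw [hq, norm_cpow_eq_rpow_re_of_pos (P.prime_pos j), neg_re]
    exact Real.rpow_lt_one_of_one_lt_of_neg (P.one_lt_prime j) (by linarith)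
  -- `log((1 − q)⁻¹) = −log(1 − q)` since `Re(1 − q) > 0`
  have hre : 0 < (1 - q).re := by
    rw [sub_re, one_re]
    linarith [(abs_re_le_norm q).trans_lt hq1, le_abs_self q.re]
  have harg : (1 - q).arg ≠ Real.pi := fun h ↦ by
    have := (Complex.arg_eq_pi_iff.1 h).1
    linarith
  rw [Complex.log_inv _ harg]
  -- Mercator
  have h := (hasSum_nat_add_iff' 1).mpr (Complex.hasSum_taylorSeries_neg_log hq1)
  simp only [Finset.range_one, Finset.sum_singleton, pow_zero, Nat.cast_zero, div_zero, sub_zero] at h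
  have hfun : (fun k : ℕ ↦ (((1 / ((k : ℝ) + 1) : ℝ)) : ℂ) * (((P.prime j ^ (k + 1) : ℝ)) : ℂ) ^ (-s)) =
      fun n : ℕ ↦ q ^ (n + 1) / ((n + 1 : ℕ) : ℂ) := by
    funext k
    rw [ofReal_pow_cpow (P.prime_pos j), hq]
    push_cast
    ring
  rw [hfun]
  exact h

/-- **`ζ_𝒫(s) = exp(s ∫₁^∞ Π_𝒫(x) x^{−s−1} dx)`**, i.e. `log ζ_𝒫(s) = ℳ{dΠ_𝒫; s}`, for `Re s > 0` with
`Σ_j λ_j^{−σ} < ∞` (BDR 2023: "`log ζ_𝒫(s) = Σ_{p_j ∈ 𝒫} log(1/(1 − p_j^{−s})) = ∫₁^∞ x^{−s} dΠ_𝒫(x)`";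
BV 2024, (3.1)). [cite: BrouckeDebruyneRevesz2023, proof of Theorem 3.2] -/
theorem _root_.Literature.Barriers.RiemannHypothesis.BeurlingPrimes.zeta_eq_exp_mul_integral_riemannPrimeCount
    {s : ℂ} (hs : 0 < s.re) (hsum : Summable fun j ↦ P.prime j ^ (-s.re)) :
    P.zeta s = Complex.exp (s * ∫ x in Ioi (1 : ℝ), ((P.riemannPrimeCount x : ℝ) : ℂ) * (x : ℂ) ^ (-s - 1)) := by
  rw [P.zeta_eq_exp_tsum hs hsum, P.mul_integral_riemannPrimeCount_eq_tsum hs hsum]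
  congr 1
  -- `Σ_j Σ_k f(j,k) = Σ_{(j,k)} f(j,k)` by absolute convergence
  set f : ℕ × ℕ → ℂ := fun jk ↦
    (((1 / ((jk.2 : ℝ) + 1) : ℝ)) : ℂ) * (((P.prime jk.1 ^ (jk.2 + 1) : ℝ)) : ℂ) ^ (-s) with hf
  have hnorm : ∀ jk, ‖f jk‖ = 1 / ((jk.2 : ℝ) + 1) * (P.prime jk.1 ^ (jk.2 + 1)) ^ (-s.re) := by
    intro jk
    rw [hf]
    simp only [norm_mul, Complex.norm_real, Real.norm_eq_abs]
    rw [abs_of_nonneg (by positivity), norm_cpow_eq_rpow_re_of_pos (pow_pos (P.prime_pos jk.1) _), neg_re]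
  have hfs : Summable f := by
    refine Summable.of_norm ?_
    simp_rw [hnorm]
    exact summable_primePow_weight P hs hsum
  rw [hfs.tsum_prod' (fun j ↦ hfs.comp_injective (Prod.mk_right_injective j))]
  refine tsum_congr fun j ↦ ?_
  exact ((P.log_eulerFactor_hasSum hs j).tsum_eq).symm

end Literature.NumberTheory.BeurlingPrimes
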